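/-
Copyright (c) 2026 the pub-hodgecm-mathlib formalisation cell (harness21).  Prover seat hodgecm-mathlib-K2E1-p11 (g5), Track B ∕ K2-LIT, h413 = `stmt-HodgeConjecture-24833`,
R90-TF section S8 «ContSpec-n½», the hCONT letter of the (R)′ ∕ (V) roads (S8 dealer R90-CS-plan (g3); R90 bus 2026-09-05T02:21:36Z (iii)): THE `L²` LETTER (MS-P′) OF THE POLE-SET
SHRINK IS FREE — the truncated `L²` family of a continued Eisenstein family is `L²`-BOUNDED near every candidate pole of an open set carrying the pointwise rows `hEd hE4 hEbd hEcinv`,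
by Cauchy's formula for the SQUARES of the pointwise-holomorphic representatives and Tonelli; so ★ K2E2-p12's `truncatedFamily_removable_of_rows` runs with `hMS` DISCHARGED.
-/
import Summits.HodgeConjecture.HodgeConjecture.Theorems.K2E1ChiTruncatedFamilyRemovableCMThree      -- ★ (K2E2-p12 g9): `differentiableAt_update_limUnder_of_eventually_bounded`, `coeFn_limUnder_ae_eq_of_ae_tendsto`, `differentiableOn_truncation_apply_of_rows`, `truncatedFamily_removable_of_rows`
import Summits.HodgeConjecture.HodgeConjecture.Theorems.K2E1ChiContinuedTruncationBoundedCMThree      -- ★ (K2E1-p16): `measurable_quotFun_truncation_continued_cm_three`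
import Mathlib.Analysis.Complex.CauchyIntegral
import HarnessLib

/-!
# h413 ∕ R90-S8 — `K2E1ChiTruncatedFamilyRemovableFreeCMThree`: THE TRUNCATED `L²` FAMILY IS `L²`-BOUNDED — HENCE REMOVABLE — AT EVERY CANDIDATE POLE OF AN OPEN SET CARRYING THE
# POINTWISE ROWS; ★ K2E2-p12's pole-set shrink WITHOUT its `L²` letter (MS-P′)

Cell `pub/hodgecm-mathlib`, crux H413 = `stmt-HodgeConjecture-24833`, route `HCCMUnconditional`; R90-TF section S8 «ContSpec-n½», the `hCONT` letter of ★ (R)′ ∕ ★ (V).  THEOREMS ONLY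
(no `def`, no `instance`, no `notation`, no named-fact hypothesis, no `sorry`; default heartbeats); lane `--supports stmt-HodgeConjecture-24833 --as helper` (count-neutral).  Closes no socket.

THE POINT.  ★ `K2E1ChiTruncatedFamilyRemovableCMThree.truncatedFamily_removable_of_rows` (K2E2-p12) extends the exports' truncated `L²(μ)`-family `Fam` (conjunct (E6)) holomorphically,
with the right a.e. value, across every candidate pole `z₀ ∈ R ⊆ P ∩ U` of an open `U` on which the continued family `Ec` carries the rows `hEd` (holomorphy per `g`), `hE4` (continuity
in `g`), `hEbd` (joint local bound), `hEcinv` (left-`G(F)`-invariance) — GIVEN, per removed point, the `L²` letter (MS-P′) `∃ C, ∀ᶠ z in 𝓝[≠] z₀, ‖Fam z‖ ≤ C`, billed to the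
Maass–Selberg road.  THIS FILE PROVES (MS-P′) FROM THOSE SAME ROWS, so the shrink is LETTER-FREE.  The argument is soft ([Conway1978, V §1; IV §2 (Cauchy's estimate)];
[MoeglinWaldspurger1995, IV.1.9–IV.1.11 is where the statement is used]): on `U` the family has the POINTWISE-holomorphic representative `F z x := quotFun (Λ^T (Ec z)) x` (★
`differentiableOn_truncation_apply_of_rows`), Borel in `x` (★ `measurable_quotFun_truncation_continued_cm_three`).  Take a circle `|ζ − z₀| = r` inside `U` avoiding `P` (`P` is
co-discrete); `Fam` is continuous on it, so `‖Fam ζ‖ ≤ M` there.  For `w` in the half-ball, Cauchy's formula for the holomorphic SQUARE `z ↦ (F z x)²` on the disc gives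
`‖F w x‖² ≤ π⁻¹ ∫_0^{2π} ‖F(ζ_θ) x‖² dθ` (no Cauchy–Schwarz needed); integrating in `x` and swapping (Tonelli — the integrand is jointly measurable because it is continuous in `θ` and
measurable in `x`, Mathlib `measurable_uncurry_of_continuous_of_measurable`) gives `‖Fam w‖²_{L²} ≤ π⁻¹ ∫_0^{2π} ‖Fam ζ_θ‖² dθ ≤ 2M²` for every `w ≠ z₀` in the half-ball.  So the
`L²` family is bounded near `z₀`, Riemann's theorem in `L²` applies (★ §1 of K2E2-p12's file), and the a.e. value is identified as there.
* §1 (generic: any measure space, `Lp ℂ 2 μ`, `μ` s-finite) **`norm_sq_le_integral_norm_sq_of_differentiableOn`** (Cauchy on squares), **`exists_eventually_norm_le_of_pointwise_differentiableOn`**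
  (THE BOUND: an `L²`-valued map differentiable on a punctured neighbourhood, a.e.-represented by a pointwise-holomorphic Borel family, is bounded near the puncture).
* §2 (CM pair, `N = 3`) **`eventually_norm_le_truncatedFamily_of_rows`** — (MS-P′) at a point of `U` from the rows; **`truncatedFamily_removable_on_of_rows`** — the LOCALISED
  letter-free shrink: `Fam` differentiable on `U ∖ P` with the a.e. rows there ⊢ `∃ Fam′, DifferentiableOn ℂ Fam′ U ∧ ∀ z ∈ U, Fam′ z =ᵐ quotFun (Λ^T (Ec z))`;
  **`truncatedFamily_removable_of_rows_free`** — ★ K2E2-p12's head VERBATIM with `hMS` discharged.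
CONSUMERS: the `hCONT` rows of ★ (R)′ (of record: ★ `hCONT_row_of_exportsRow`; τ: ★ p864188) then follow from the per-generator exports-with-(E6) ALONE (`T := 1`, `S := ∅`, `U :=`
the generator's slit plane) — next file `R90S8ResGMidHContRowsFreeU3`.
HONEST LABEL: HC_CM is proved only modulo the 7 printed citations (2 remaining named inputs: hLiu418 = `stmt-HodgeConjecture-24832`, h413 = `stmt-HodgeConjecture-24833`) until rung 0
closes; this file asserts no named fact and closes no socket; it removes ONE letter ((MS-P′) for the truncated family) from the hCONT column — the pole ledger of the WITNESS
(`Sp = {3∕2}`) is untouched; count-neutral.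

## References
* [Conway1978] J. B. Conway, *Functions of One Complex Variable I*, 2nd ed. (1978), IV §2 (Cauchy's integral formula and estimate), V §1 (removable singularities).
* [MoeglinWaldspurger1995] C. Mœglin, J.-L. Waldspurger, *Spectral Decomposition and Eisenstein Series* (1995), I.2.13, IV.1.9–IV.1.11, IV.2.3.
* [BernsteinLapid2019] J. Bernstein, E. Lapid, *On the meromorphic continuation of Eisenstein series*, J. Amer. Math. Soc. 37 (2024), Thm 2.3, §4 p. 10.
* [Arthur1980TraceFormulaII] J. Arthur, *A trace formula for reductive groups II*, Compos. Math. 40 (1980), §1.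
-/

set_option autoImplicit false
set_option linter.dupNamespace false  -- the mandated namespace repeats the summit's segment (`HodgeConjecture.HodgeConjecture`)

noncomputable section

open MeasureTheory Measure Set Filter Topology Function Metric Complex
open scoped ENNReal NNReal Real
open Literature.NumberTheory.Automorphic Literature.NumberTheory.Automorphic.UnitaryGroup AdelicGroupData NumberField IsDedekindDomain
open Summit.HodgeConjecture.HodgeConjecture.Cruxes.H413.K2E1ChiTruncatedFamilyRemovableCMThree
  (differentiableAt_update_limUnder_of_eventually_bounded coeFn_limUnder_ae_eq_of_ae_tendsto differentiableOn_truncation_apply_of_rows truncatedFamily_removable_of_rows)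
open Summit.HodgeConjecture.HodgeConjecture.Cruxes.H413.K2E1ChiContinuedTruncationBoundedCMThree (measurable_quotFun_truncation_continued_cm_three)

namespace Summit.HodgeConjecture.HodgeConjecture.Cruxes.H413.K2E1ChiTruncatedFamilyRemovableFreeCMThree

/-! ## §1 Generic: an `L²`-valued map with a pointwise-holomorphic Borel representative is bounded near a puncture -/

section Generic

/-- **CAUCHY ON SQUARES**: for `G` holomorphic on `U ⊇ closedBall c r` (`0 < r`) and `w` in the half-ball, `‖G w‖² ≤ π⁻¹·∫_0^{2π} ‖G(c + r e^{iθ})‖² dθ` — Cauchy's integral formula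
for the holomorphic function `G²` on the disc of radius `r`, and `|ζ − w| ≥ r∕2` on the circle. [cite: Conway1978, IV §2] -/
theorem norm_sq_le_integral_norm_sq_of_differentiableOn {G : ℂ → ℂ} {U : Set ℂ} {c : ℂ} {r : ℝ} (hr : 0 < r)
    (hG : DifferentiableOn ℂ G U) (hU : closedBall c r ⊆ U) {w : ℂ} (hw : w ∈ ball c (r / 2)) :
    ‖G w‖ ^ 2 ≤ π⁻¹ * ∫ θ in (0 : ℝ)..2 * π, ‖G (circleMap c r θ)‖ ^ 2 := by
  have hG2 : DiffContOnCl ℂ (fun z => G z ^ 2) (ball c r) := (hG.pow 2).diffContOnCl_ball hU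
  have hw' : w ∈ ball c r := ball_subset_ball (by linarith) hw
  have hC := hG2.circleIntegral_sub_inv_smul hw'
  -- the norm of the right-hand side of Cauchy's formula
  have hnorm : ‖(2 * π * I : ℂ) • G w ^ 2‖ = 2 * π * ‖G w‖ ^ 2 := by
    rw [norm_smul, norm_pow, norm_mul, norm_mul, Complex.norm_I, mul_one, Complex.norm_real, Real.norm_eq_abs, abs_of_pos Real.pi_pos,
      Complex.norm_two]
  -- the circle integrand is dominated by `2·‖G(ζ_θ)‖²`
  have hGc : Continuous fun θ : ℝ => G (circleMap c r θ) :=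
    hG.continuousOn.comp_continuous (continuous_circleMap c r) fun θ => hU (sphere_subset_closedBall (circleMap_mem_sphere c hr.le θ))
  have hint : ‖∮ z in C(c, r), (z - w)⁻¹ • G z ^ 2‖ ≤ ∫ θ in (0 : ℝ)..2 * π, 2 * ‖G (circleMap c r θ)‖ ^ 2 := by
    rw [circleIntegral]
    refine intervalIntegral.norm_integral_le_of_norm_le (by positivity) (ae_of_all _ fun θ _ => ?_)
      ((continuous_const.mul ((continuous_norm.comp hGc).pow 2)).intervalIntegrable _ _)
    have hdist : r / 2 ≤ ‖circleMap c r θ - w‖ := by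
      have h1 : ‖circleMap c r θ - c‖ = r := by rw [circleMap_sub_center, norm_circleMap_zero, abs_of_pos hr]
      have h2 : ‖w - c‖ < r / 2 := by rwa [mem_ball, dist_eq_norm] at hw
      have h3 : ‖circleMap c r θ - c‖ ≤ ‖circleMap c r θ - w‖ + ‖w - c‖ := norm_sub_le_norm_sub_add_norm_sub _ _ _
      linarith
    have hinv : ‖circleMap c r θ - w‖⁻¹ ≤ (r / 2)⁻¹ := inv_anti₀ (by positivity) hdist
    rw [norm_smul, norm_smul, norm_inv, norm_pow, deriv_circleMap, norm_mul, norm_circleMap_zero, Complex.norm_I, mul_one, abs_of_pos hr]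
    calc r * (‖circleMap c r θ - w‖⁻¹ * ‖G (circleMap c r θ)‖ ^ 2) ≤ r * ((r / 2)⁻¹ * ‖G (circleMap c r θ)‖ ^ 2) := by gcongr
      _ = 2 * ‖G (circleMap c r θ)‖ ^ 2 := by field_simp
  rw [hC, hnorm, intervalIntegral.integral_const_mul] at hint
  rw [inv_mul_eq_div, le_div_iff₀ Real.pi_pos]
  linarith

variable {α : Type*} [MeasurableSpace α] {μ : Measure α} [SFinite μ]

/-- **THE `L²` BOUND NEAR A PUNCTURE FROM A POINTWISE-HOLOMORPHIC BOREL REPRESENTATIVE** (module docstring).  `Fam : ℂ → Lp ℂ 2 μ` is complex differentiable on a punctured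
neighbourhood of `c` and represents `F z` a.e. there; on a neighbourhood `U` of `c`, `z ↦ F z x` is holomorphic for EVERY `x` and `F z` is Borel for every `z ∈ U`.  THEN `‖Fam z‖` is
bounded on a punctured neighbourhood of `c`.  PROOF: a circle `|ζ − c| = r` in the punctured region, `‖Fam ζ‖ ≤ M` on it (continuity on the compact sphere); Cauchy on squares
(`norm_sq_le_integral_norm_sq_of_differentiableOn`) bounds `‖F w x‖²` by `π⁻¹∫_0^{2π}‖F ζ_θ x‖²dθ` for `w` in the half-ball; Tonelli (joint measurability by
`measurable_uncurry_of_continuous_of_measurable`) turns the `x`-integral of the right-hand side into `∫_0^{2π}‖Fam ζ_θ‖²_{L²}dθ ≤ 2πM²`. [cite: Conway1978, IV §2, V §1] -/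
theorem exists_eventually_norm_le_of_pointwise_differentiableOn (Fam : ℂ → Lp ℂ 2 μ) {c : ℂ}
    (hda : ∀ᶠ z in 𝓝[≠] c, DifferentiableAt ℂ Fam z)
    (F : ℂ → α → ℂ) (hFam : ∀ᶠ z in 𝓝[≠] c, ((Fam z : Lp ℂ 2 μ) : α → ℂ) =ᵐ[μ] F z)
    {U : Set ℂ} (hU : U ∈ 𝓝 c) (hF : ∀ x, DifferentiableOn ℂ (fun z => F z x) U) (hFm : ∀ z ∈ U, Measurable (F z)) :
    ∃ C : ℝ, ∀ᶠ z in 𝓝[≠] c, ‖Fam z‖ ≤ C := by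
  -- a radius `r > 0` with `closedBall c r ⊆ U` and both punctured rows on `closedBall c r ∖ {c}`
  obtain ⟨ε, hε, hεsub⟩ : ∃ ε > 0, ball c ε ⊆ {z | z ≠ c → DifferentiableAt ℂ Fam z ∧ ((Fam z : Lp ℂ 2 μ) : α → ℂ) =ᵐ[μ] F z} ∩ U :=
    Metric.mem_nhds_iff.1 (inter_mem (eventually_nhdsWithin_iff.1 (hda.and hFam)) hU)
  set r : ℝ := ε / 2 with hr_def
  have hr : 0 < r := by positivity
  have hrε : r < ε := by rw [hr_def]; linarith
  have hclU : closedBall c r ⊆ U := fun z hz => (hεsub (closedBall_subset_ball hrε hz)).2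
  have hrow : ∀ z ∈ closedBall c r, z ≠ c → DifferentiableAt ℂ Fam z ∧ ((Fam z : Lp ℂ 2 μ) : α → ℂ) =ᵐ[μ] F z :=
    fun z hz hzc => (hεsub (closedBall_subset_ball hrε hz)).1 hzc
  have hsph : ∀ θ : ℝ, circleMap c r θ ∈ closedBall c r ∧ circleMap c r θ ≠ c := fun θ =>
    ⟨sphere_subset_closedBall (circleMap_mem_sphere c hr.le θ), circleMap_ne_center hr.ne'⟩
  -- `Fam` is bounded on the circle
  obtain ⟨M, hM⟩ : ∃ M : ℝ, ∀ ζ ∈ sphere c r, ‖Fam ζ‖ ≤ M := by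
    have hcont : ContinuousOn Fam (sphere c r) := fun ζ hζ =>
      (hrow ζ (sphere_subset_closedBall hζ) (ne_of_mem_sphere hζ hr.ne')).1.continuousAt.continuousWithinAt
    exact (isCompact_sphere c r).exists_bound_of_continuousOn hcont
  -- joint measurability of `(θ, x) ↦ F (ζ_θ) x` (continuous in `θ`, Borel in `x`)
  have hFθc : ∀ x, Continuous fun θ : ℝ => F (circleMap c r θ) x := fun x =>
    (hF x).continuousOn.comp_continuous (continuous_circleMap c r) fun θ => hclU (hsph θ).1
  have hjm : Measurable (Function.uncurry fun (θ : ℝ) (x : α) => F (circleMap c r θ) x) :=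
    measurable_uncurry_of_continuous_of_measurable hFθc fun θ => hFm _ (hclU (hsph θ).1)
  -- `∫⁻ ‖f‖ₑ² = ‖f‖ₑ²` on `Lp ℂ 2 μ`
  have key : ∀ f : α → ℂ, ∫⁻ x, ‖f x‖ₑ ^ (2 : ℝ) ∂μ = eLpNorm f 2 μ ^ (2 : ℝ) := fun f => by
    rw [lintegral_rpow_enorm_eq_rpow_eLpNorm' two_pos, eLpNorm_eq_eLpNorm' two_ne_zero ENNReal.ofNat_ne_top, ENNReal.toReal_ofNat]
  have hsq : ∀ a : ℂ, ‖a‖ₑ ^ (2 : ℝ) = ENNReal.ofReal (‖a‖ ^ 2) := fun a => by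
    rw [ENNReal.rpow_two, ← ofReal_norm, ENNReal.ofReal_pow (norm_nonneg _)]
  -- the circle term: `∫⁻ x, ‖F ζ_θ x‖ₑ² ≤ (ofReal M)²`
  have hcirc : ∀ θ : ℝ, ∫⁻ x, ‖F (circleMap c r θ) x‖ₑ ^ (2 : ℝ) ∂μ ≤ ENNReal.ofReal M ^ (2 : ℝ) := fun θ => by
    have hae := (hrow _ (hsph θ).1 (hsph θ).2).2
    have hcongr : (fun x => ‖F (circleMap c r θ) x‖ₑ ^ (2 : ℝ)) =ᵐ[μ] fun x => ‖(Fam (circleMap c r θ) : α → ℂ) x‖ₑ ^ (2 : ℝ) :=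
      hae.mono fun x hx => by simp only [hx]
    rw [lintegral_congr_ae hcongr, key, ← Lp.enorm_def, ← ofReal_norm]
    exact ENNReal.rpow_le_rpow (ENNReal.ofReal_le_ofReal (hM _ (circleMap_mem_sphere c hr.le θ))) (by norm_num)
  -- Tonelli
  have hswap : ∫⁻ x, ∫⁻ θ in Ioc (0 : ℝ) (2 * π), ‖F (circleMap c r θ) x‖ₑ ^ (2 : ℝ) ∂volume ∂μ =
      ∫⁻ θ in Ioc (0 : ℝ) (2 * π), ∫⁻ x, ‖F (circleMap c r θ) x‖ₑ ^ (2 : ℝ) ∂μ ∂volume :=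
    lintegral_lintegral_swap ((hjm.comp measurable_swap).enorm.pow_const _).aemeasurable
  have hK : ∫⁻ θ in Ioc (0 : ℝ) (2 * π), ∫⁻ x, ‖F (circleMap c r θ) x‖ₑ ^ (2 : ℝ) ∂μ ∂volume ≤ ENNReal.ofReal M ^ (2 : ℝ) * volume (Ioc (0 : ℝ) (2 * π)) := by
    rw [← setLIntegral_const]
    exact lintegral_mono fun θ => hcirc θ
  have hKtop : ENNReal.ofReal M ^ (2 : ℝ) * volume (Ioc (0 : ℝ) (2 * π)) ≠ ⊤ :=
    ENNReal.mul_ne_top (ENNReal.rpow_ne_top_of_nonneg (by norm_num) ENNReal.ofReal_ne_top) (by rw [Real.volume_Ioc]; exact ENNReal.ofReal_ne_top)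
  -- the real integral `∫_0^{2π} ‖F ζ_θ x‖² dθ` as a lintegral
  have hIx : ∀ x, ENNReal.ofReal (∫ θ in (0 : ℝ)..2 * π, ‖F (circleMap c r θ) x‖ ^ 2) = ∫⁻ θ in Ioc (0 : ℝ) (2 * π), ‖F (circleMap c r θ) x‖ₑ ^ (2 : ℝ) ∂volume := fun x => by
    have hc2 : Continuous fun θ : ℝ => ‖F (circleMap c r θ) x‖ ^ 2 := (continuous_norm.comp (hFθc x)).pow 2
    rw [intervalIntegral.integral_of_le (by positivity), ofReal_integral_eq_lintegral_ofReal (hc2.intervalIntegrable _ _).1 (ae_of_all _ fun θ => by positivity)]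
    exact lintegral_congr fun θ => (hsq _).symm
  -- the bound on the half-ball
  refine ⟨((ENNReal.ofReal M ^ (2 : ℝ) * volume (Ioc (0 : ℝ) (2 * π))) ^ (2 : ℝ)⁻¹).toReal,
    eventually_nhdsWithin_iff.2 (Filter.eventually_of_mem (ball_mem_nhds c (half_pos hr)) fun w hw hwc => ?_)⟩
  have hwc' : w ≠ c := hwc
  have hwcl : w ∈ closedBall c r := ball_subset_closedBall (ball_subset_ball (by linarith) hw)
  obtain ⟨-, hae⟩ := hrow w hwcl hwc'
  -- pointwise: `‖F w x‖ₑ² ≤ ∫⁻_θ ‖F ζ_θ x‖ₑ²`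
  have hpt : ∀ x, ‖F w x‖ₑ ^ (2 : ℝ) ≤ ∫⁻ θ in Ioc (0 : ℝ) (2 * π), ‖F (circleMap c r θ) x‖ₑ ^ (2 : ℝ) ∂volume := fun x => by
    rw [hsq, ← hIx]
    refine ENNReal.ofReal_le_ofReal ((norm_sq_le_integral_norm_sq_of_differentiableOn hr (hF x) hclU hw).trans ?_)
    have hI0 : 0 ≤ ∫ θ in (0 : ℝ)..2 * π, ‖F (circleMap c r θ) x‖ ^ 2 := intervalIntegral.integral_nonneg (by positivity) fun θ _ => by positivity
    exact mul_le_of_le_one_left hI0 (inv_le_one_of_one_le₀ (by linarith [Real.pi_gt_three]))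
  have hbound : ‖Fam w‖ₑ ^ (2 : ℝ) ≤ ENNReal.ofReal M ^ (2 : ℝ) * volume (Ioc (0 : ℝ) (2 * π)) := by
    have hcongr : (fun x => ‖(Fam w : α → ℂ) x‖ₑ ^ (2 : ℝ)) =ᵐ[μ] fun x => ‖F w x‖ₑ ^ (2 : ℝ) := hae.mono fun x hx => by simp only [hx]
    rw [Lp.enorm_def, ← key, lintegral_congr_ae hcongr]
    exact ((lintegral_mono hpt).trans_eq hswap).trans hK
  have hle : ‖Fam w‖ₑ ≤ (ENNReal.ofReal M ^ (2 : ℝ) * volume (Ioc (0 : ℝ) (2 * π))) ^ (2 : ℝ)⁻¹ := (ENNReal.le_rpow_inv_iff two_pos).2 hbound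
  rw [← toReal_enorm]
  exact ENNReal.toReal_mono (ENNReal.rpow_ne_top_of_nonneg (by norm_num) hKtop) hle

end Generic

/-! ## §2 The CM pair `L ∕ L⁺`, `N = 3`: (MS-P′) from the rows, and the letter-free pole-set shrink -/

section CM

variable (L : Type) [Field L] [NumberField L] [IsCMField L]
variable [MeasurableSpace (quasiSplit (↥(maximalRealSubfield L)) L (IsCMField.complexConj L) 3).Adelic] [BorelSpace (quasiSplit (↥(maximalRealSubfield L)) L (IsCMField.complexConj L) 3).Adelic]

/-- **(MS-P′) FROM THE ROWS**: on an open `U` where the continued family `Ec` carries `hEd hE4 hEbd hEcinv` (`T ≥ 1`, `ν` Haar, `𝓕` a fundamental domain of compact closure, `μ` s-finite), an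
`L²(μ)`-valued map `Fam`, complex differentiable on a punctured neighbourhood of `c ∈ U` and representing `quotFun (Λ^T (Ec z))` a.e. there, is BOUNDED near `c` — §1 with the
pointwise-holomorphic representative ★ `differentiableOn_truncation_apply_of_rows` and its Borel measurability ★ `measurable_quotFun_truncation_continued_cm_three`.
[cite: Conway1978, IV §2, V §1] [cite: MoeglinWaldspurger1995, I.2.13, IV.1.9] -/
theorem eventually_norm_le_truncatedFamily_of_rows
    (μ : Measure (quasiSplit (↥(maximalRealSubfield L)) L (IsCMField.complexConj L) 3).automorphicQuotient) [SFinite μ]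
    (ν : Measure ↥(adelicUnipotent (↥(maximalRealSubfield L)) L (IsCMField.complexConj L) 3)) [ν.IsHaarMeasure]
    {𝓕 : Set ↥(adelicUnipotent (↥(maximalRealSubfield L)) L (IsCMField.complexConj L) 3)}
    (h𝓕N : IsFundamentalDomain ↥(rationalUnipotent (↥(maximalRealSubfield L)) L (IsCMField.complexConj L) 3) 𝓕 ν) (h𝓕c : IsCompact (closure 𝓕)) {T : ℝ≥0} (hT : 1 ≤ T)
    (Ec : ℂ → (quasiSplit (↥(maximalRealSubfield L)) L (IsCMField.complexConj L) 3).Adelic → ℂ) {U : Set ℂ} (hUo : IsOpen U)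
    (hEd : ∀ g, DifferentiableOn ℂ (fun z => Ec z g) U) (hE4 : ∀ z ∈ U, Continuous (Ec z))
    (hEbd : ∀ z₀ ∈ U, ∀ K : Set (quasiSplit (↥(maximalRealSubfield L)) L (IsCMField.complexConj L) 3).Adelic, IsCompact K → ∃ V ∈ 𝓝 z₀, ∃ M : ℝ, ∀ z ∈ V, ∀ g ∈ K, ‖Ec z g‖ ≤ M)
    (hEcinv : ∀ z ∈ U, ∀ (γ : (quasiSplit (↥(maximalRealSubfield L)) L (IsCMField.complexConj L) 3).arithmeticSubgroup) (x : (quasiSplit (↥(maximalRealSubfield L)) L (IsCMField.complexConj L) 3).Adelic),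
      Ec z ((γ : (quasiSplit (↥(maximalRealSubfield L)) L (IsCMField.complexConj L) 3).Adelic) * x) = Ec z x)
    (Fam : ℂ → Lp ℂ 2 μ) {c : ℂ} (hc : c ∈ U) (hda : ∀ᶠ z in 𝓝[≠] c, DifferentiableAt ℂ Fam z)
    (hFam : ∀ᶠ z in 𝓝[≠] c, ((Fam z : Lp ℂ 2 μ) : (quasiSplit (↥(maximalRealSubfield L)) L (IsCMField.complexConj L) 3).automorphicQuotient → ℂ) =ᵐ[μ]
      (quasiSplit (↥(maximalRealSubfield L)) L (IsCMField.complexConj L) 3).quotFun (truncation ν 𝓕 T (Ec z))) :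
    ∃ C : ℝ, ∀ᶠ z in 𝓝[≠] c, ‖Fam z‖ ≤ C :=
  exists_eventually_norm_le_of_pointwise_differentiableOn Fam hda (fun z => (quasiSplit (↥(maximalRealSubfield L)) L (IsCMField.complexConj L) 3).quotFun (truncation ν 𝓕 T (Ec z)))
    hFam (hUo.mem_nhds hc)
    (fun x => differentiableOn_truncation_apply_of_rows ν h𝓕N h𝓕c hT Ec hUo hEd hE4 hEbd hEcinv
      (Quotient.out (x : (quasiSplit (↥(maximalRealSubfield L)) L (IsCMField.complexConj L) 3).Adelic ⧸ (quasiSplit (↥(maximalRealSubfield L)) L (IsCMField.complexConj L) 3).quotientSubgroup))⁻¹)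
    fun _ hz => measurable_quotFun_truncation_continued_cm_three L ν h𝓕N Ec hE4 hEcinv hT hz

/-- **THE LETTER-FREE POLE-SET SHRINK, LOCALISED TO AN OPEN SET CARRYING THE ROWS.**  `P` closed and co-discrete; `U` open with the rows `hEd hE4 hEbd hEcinv` for `Ec` (`T ≥ 1`; `ν`,
`𝓕` as above; `μ` s-finite); `Fam : ℂ → Lp ℂ 2 μ` differentiable on `U ∖ P` and representing `quotFun (Λ^T (Ec z))` a.e. at every `z ∈ U ∖ P`.  THEN there is `Fam′ : ℂ → Lp ℂ 2 μ`,
holomorphic on ALL of `U`, representing `quotFun (Λ^T (Ec z))` a.e. at EVERY `z ∈ U` — `Fam′ :=` `Fam` redefined on `P` by its punctured `L²`-limits: Riemann in `L²` (★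
`differentiableAt_update_limUnder_of_eventually_bounded`) on the bound of `eventually_norm_le_truncatedFamily_of_rows`, the a.e. value by ★ `coeFn_limUnder_ae_eq_of_ae_tendsto` and the
pointwise continuity ★ `differentiableOn_truncation_apply_of_rows`. [cite: Conway1978, V §1] [cite: MoeglinWaldspurger1995, IV.1.9–IV.1.11, IV.2.3] [cite: BernsteinLapid2019, Thm 2.3, §4 p. 10] -/
theorem truncatedFamily_removable_on_of_rows
    (μ : Measure (quasiSplit (↥(maximalRealSubfield L)) L (IsCMField.complexConj L) 3).automorphicQuotient) [SFinite μ]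
    (ν : Measure ↥(adelicUnipotent (↥(maximalRealSubfield L)) L (IsCMField.complexConj L) 3)) [ν.IsHaarMeasure]
    {𝓕 : Set ↥(adelicUnipotent (↥(maximalRealSubfield L)) L (IsCMField.complexConj L) 3)}
    (h𝓕N : IsFundamentalDomain ↥(rationalUnipotent (↥(maximalRealSubfield L)) L (IsCMField.complexConj L) 3) 𝓕 ν) (h𝓕c : IsCompact (closure 𝓕)) {T : ℝ≥0} (hT : 1 ≤ T)
    (Ec : ℂ → (quasiSplit (↥(maximalRealSubfield L)) L (IsCMField.complexConj L) 3).Adelic → ℂ) {P : Set ℂ} (hPc : IsClosed P) (hPcd : ∀ z₀ : ℂ, ∀ᶠ s in 𝓝[≠] z₀, s ∉ P)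
    {U : Set ℂ} (hUo : IsOpen U)
    (hEd : ∀ g, DifferentiableOn ℂ (fun z => Ec z g) U) (hE4 : ∀ z ∈ U, Continuous (Ec z))
    (hEbd : ∀ z₀ ∈ U, ∀ K : Set (quasiSplit (↥(maximalRealSubfield L)) L (IsCMField.complexConj L) 3).Adelic, IsCompact K → ∃ V ∈ 𝓝 z₀, ∃ M : ℝ, ∀ z ∈ V, ∀ g ∈ K, ‖Ec z g‖ ≤ M)
    (hEcinv : ∀ z ∈ U, ∀ (γ : (quasiSplit (↥(maximalRealSubfield L)) L (IsCMField.complexConj L) 3).arithmeticSubgroup) (x : (quasiSplit (↥(maximalRealSubfield L)) L (IsCMField.complexConj L) 3).Adelic),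
      Ec z ((γ : (quasiSplit (↥(maximalRealSubfield L)) L (IsCMField.complexConj L) 3).Adelic) * x) = Ec z x)
    (Fam : ℂ → Lp ℂ 2 μ) (hFd : DifferentiableOn ℂ Fam (U \ P))
    (hFam : ∀ z ∈ U \ P, ((Fam z : Lp ℂ 2 μ) : (quasiSplit (↥(maximalRealSubfield L)) L (IsCMField.complexConj L) 3).automorphicQuotient → ℂ) =ᵐ[μ]
      (quasiSplit (↥(maximalRealSubfield L)) L (IsCMField.complexConj L) 3).quotFun (truncation ν 𝓕 T (Ec z))) :
    ∃ Fam' : ℂ → Lp ℂ 2 μ, DifferentiableOn ℂ Fam' U ∧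
      ∀ z ∈ U, ((Fam' z : Lp ℂ 2 μ) : (quasiSplit (↥(maximalRealSubfield L)) L (IsCMField.complexConj L) 3).automorphicQuotient → ℂ) =ᵐ[μ]
        (quasiSplit (↥(maximalRealSubfield L)) L (IsCMField.complexConj L) 3).quotFun (truncation ν 𝓕 T (Ec z)) := by
  classical
  have hUPo : IsOpen (U \ P) := hUo.sdiff hPc
  -- punctured neighbourhoods of a point of `U` lie in `U ∖ P`
  have hpunct : ∀ c ∈ U, ∀ᶠ z in 𝓝[≠] c, z ∈ U \ P := fun c hc => by
    have h1 : ∀ᶠ z in 𝓝[≠] c, z ∈ U := mem_nhdsWithin_of_mem_nhds (hUo.mem_nhds hc)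
    exact (h1.and (hPcd c)).mono fun z hz => ⟨hz.1, hz.2⟩
  have hda : ∀ c ∈ U, ∀ᶠ z in 𝓝[≠] c, DifferentiableAt ℂ Fam z := fun c hc =>
    (hpunct c hc).mono fun z hz => hFd.differentiableAt (hUPo.mem_nhds hz)
  have hrows : ∀ c ∈ U, ∀ᶠ z in 𝓝[≠] c, ((Fam z : Lp ℂ 2 μ) : (quasiSplit (↥(maximalRealSubfield L)) L (IsCMField.complexConj L) 3).automorphicQuotient → ℂ) =ᵐ[μ]
      (quasiSplit (↥(maximalRealSubfield L)) L (IsCMField.complexConj L) 3).quotFun (truncation ν 𝓕 T (Ec z)) := fun c hc => (hpunct c hc).mono fun z hz => hFam z hz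
  -- (MS-P′) from the rows, at every point of `U`
  have hMS : ∀ c ∈ U, ∃ C : ℝ, ∀ᶠ z in 𝓝[≠] c, ‖Fam z‖ ≤ C := fun c hc =>
    eventually_norm_le_truncatedFamily_of_rows L μ ν h𝓕N h𝓕c hT Ec hUo hEd hE4 hEbd hEcinv Fam hc (hda c hc) (hrows c hc)
  -- pointwise continuity of the representative and the a.e. value of the punctured limit
  have hptw : ∀ c ∈ U, ∀ x : (quasiSplit (↥(maximalRealSubfield L)) L (IsCMField.complexConj L) 3).automorphicQuotient,
      Tendsto (fun z => (quasiSplit (↥(maximalRealSubfield L)) L (IsCMField.complexConj L) 3).quotFun (truncation ν 𝓕 T (Ec z)) x) (𝓝[≠] c)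
        (𝓝 ((quasiSplit (↥(maximalRealSubfield L)) L (IsCMField.complexConj L) 3).quotFun (truncation ν 𝓕 T (Ec c)) x)) := fun c hc x => by
    have hd := differentiableOn_truncation_apply_of_rows ν h𝓕N h𝓕c hT Ec hUo hEd hE4 hEbd hEcinv
      (Quotient.out (x : (quasiSplit (↥(maximalRealSubfield L)) L (IsCMField.complexConj L) 3).Adelic ⧸ (quasiSplit (↥(maximalRealSubfield L)) L (IsCMField.complexConj L) 3).quotientSubgroup))⁻¹
    exact ((hd.differentiableAt (hUo.mem_nhds hc)).continuousAt.tendsto).mono_left nhdsWithin_le_nhds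
  have hval : ∀ c ∈ U, ((limUnder (𝓝[≠] c) Fam : Lp ℂ 2 μ) : (quasiSplit (↥(maximalRealSubfield L)) L (IsCMField.complexConj L) 3).automorphicQuotient → ℂ) =ᵐ[μ]
      (quasiSplit (↥(maximalRealSubfield L)) L (IsCMField.complexConj L) 3).quotFun (truncation ν 𝓕 T (Ec c)) := fun c hc =>
    coeFn_limUnder_ae_eq_of_ae_tendsto Fam (hda c hc) (hMS c hc) (fun z => (quasiSplit (↥(maximalRealSubfield L)) L (IsCMField.complexConj L) 3).quotFun (truncation ν 𝓕 T (Ec z)))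
      (hrows c hc) (ae_of_all _ fun x => hptw c hc x)
  refine ⟨fun z => if z ∈ P then limUnder (𝓝[≠] z) Fam else Fam z, fun z hz => ?_, fun z hz => ?_⟩
  · by_cases hzP : z ∈ P
    · have hev : (fun w => if w ∈ P then limUnder (𝓝[≠] w) Fam else Fam w) =ᶠ[𝓝 z] update Fam z (limUnder (𝓝[≠] z) Fam) := by
        have h1 : ∀ᶠ w in 𝓝 z, w ≠ z → w ∉ P := eventually_nhdsWithin_iff.1 (hPcd z)
        filter_upwards [h1] with w hw
        by_cases hwz : w = z
        · subst hwz; simp [hzP]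
        · rw [update_of_ne hwz, if_neg (hw hwz)]
      exact ((differentiableAt_update_limUnder_of_eventually_bounded (hda z hz) (hMS z hz)).congr_of_eventuallyEq hev).differentiableWithinAt
    · have hev : (fun w => if w ∈ P then limUnder (𝓝[≠] w) Fam else Fam w) =ᶠ[𝓝 z] Fam := by
        filter_upwards [hPc.isOpen_compl.mem_nhds hzP] with w hw
        rw [if_neg hw]
      exact ((hFd.differentiableAt (hUPo.mem_nhds ⟨hz, hzP⟩)).congr_of_eventuallyEq hev).differentiableWithinAt
  · by_cases hzP : z ∈ P
    · simp only [if_pos hzP]; exact hval z hz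
    · simp only [if_neg hzP]; exact hFam z ⟨hz, hzP⟩

/-- **★ K2E2-p12's POLE-SET SHRINK WITH ITS `L²` LETTER DISCHARGED**: ★ `truncatedFamily_removable_of_rows` VERBATIM minus `hMS` (plus `μ` s-finite) — the (MS-P′) letter at every
`z₀ ∈ R ⊆ P ∩ U` is `eventually_norm_le_truncatedFamily_of_rows`. [cite: MoeglinWaldspurger1995, IV.1.9–IV.1.11, IV.2.3] [cite: BernsteinLapid2019, Thm 2.3, §4 p. 10] [cite: Conway1978, V §1] -/
theorem truncatedFamily_removable_of_rows_free
    (μ : Measure (quasiSplit (↥(maximalRealSubfield L)) L (IsCMField.complexConj L) 3).automorphicQuotient) [SFinite μ]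
    (ν : Measure ↥(adelicUnipotent (↥(maximalRealSubfield L)) L (IsCMField.complexConj L) 3)) [ν.IsHaarMeasure]
    {𝓕 : Set ↥(adelicUnipotent (↥(maximalRealSubfield L)) L (IsCMField.complexConj L) 3)}
    (h𝓕N : IsFundamentalDomain ↥(rationalUnipotent (↥(maximalRealSubfield L)) L (IsCMField.complexConj L) 3) 𝓕 ν) (h𝓕c : IsCompact (closure 𝓕)) {T : ℝ≥0} (hT : 1 ≤ T)
    (Ec : ℂ → (quasiSplit (↥(maximalRealSubfield L)) L (IsCMField.complexConj L) 3).Adelic → ℂ) {P : Set ℂ} (hPc : IsClosed P) (hPcd : ∀ z₀ : ℂ, ∀ᶠ s in 𝓝[≠] z₀, s ∉ P)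
    (Fam : ℂ → Lp ℂ 2 μ) (hFd : DifferentiableOn ℂ Fam Pᶜ)
    (hFam : ∀ z : ℂ, z ∉ P → ((Fam z : Lp ℂ 2 μ) : (quasiSplit (↥(maximalRealSubfield L)) L (IsCMField.complexConj L) 3).automorphicQuotient → ℂ) =ᵐ[μ]
      (quasiSplit (↥(maximalRealSubfield L)) L (IsCMField.complexConj L) 3).quotFun (truncation ν 𝓕 T (Ec z)))
    {U : Set ℂ} (hUo : IsOpen U) (hEd : ∀ g, DifferentiableOn ℂ (fun z => Ec z g) U) (hE4 : ∀ z ∈ U, Continuous (Ec z))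
    (hEbd : ∀ z₀ ∈ U, ∀ K : Set (quasiSplit (↥(maximalRealSubfield L)) L (IsCMField.complexConj L) 3).Adelic, IsCompact K → ∃ V ∈ 𝓝 z₀, ∃ M : ℝ, ∀ z ∈ V, ∀ g ∈ K, ‖Ec z g‖ ≤ M)
    (hEcinv : ∀ z ∈ U, ∀ (γ : (quasiSplit (↥(maximalRealSubfield L)) L (IsCMField.complexConj L) 3).arithmeticSubgroup) (x : (quasiSplit (↥(maximalRealSubfield L)) L (IsCMField.complexConj L) 3).Adelic),
      Ec z ((γ : (quasiSplit (↥(maximalRealSubfield L)) L (IsCMField.complexConj L) 3).Adelic) * x) = Ec z x)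
    {R : Set ℂ} (hRP : R ⊆ P) (hRU : R ⊆ U) :
    ∃ Fam' : ℂ → Lp ℂ 2 μ, DifferentiableOn ℂ Fam' (P \ R)ᶜ ∧
      ∀ z : ℂ, z ∉ P \ R → ((Fam' z : Lp ℂ 2 μ) : (quasiSplit (↥(maximalRealSubfield L)) L (IsCMField.complexConj L) 3).automorphicQuotient → ℂ) =ᵐ[μ]
        (quasiSplit (↥(maximalRealSubfield L)) L (IsCMField.complexConj L) 3).quotFun (truncation ν 𝓕 T (Ec z)) :=
  truncatedFamily_removable_of_rows μ ν h𝓕N h𝓕c hT Ec hPc hPcd Fam hFd hFam hUo hEd hE4 hEbd hEcinv hRP hRU fun z₀ hz₀ =>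
    eventually_norm_le_truncatedFamily_of_rows L μ ν h𝓕N h𝓕c hT Ec hUo hEd hE4 hEbd hEcinv Fam (hRU hz₀)
      ((hPcd z₀).mono fun _ hz => hFd.differentiableAt (hPc.isOpen_compl.mem_nhds hz)) ((hPcd z₀).mono fun z hz => hFam z hz)

end CM

end Summit.HodgeConjecture.HodgeConjecture.Cruxes.H413.K2E1ChiTruncatedFamilyRemovableFreeCMThree

end
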